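import Summits.AtomisticToContinuum.Crystallization.Theorems.ThreeConeCertificateSlackRigidityPinsMinimisers
import HarnessLib

/-!
# `SlackRigidity` (stmt-AtomisticToContinuum-11960): all periodic minimisers are mutually locally congruent

Support file for the crux `ThreeConeCertificate.SlackRigidity` (line `ekeland-surgery-parity`),
corollaries of `SlackRigidityPinsMinimisers.siteMatched_of_rigidFor` (lead c12).

* `minimisers_locally_congruent` / `slackRigidity_minimisers_congruent` — under the crux, for ANY two
  periodic Lennard-Jones minimisers `Q₁, Q₂`, any sites `s₁ ∈ Q₁.points`, `s₂ ∈ Q₂.points` and all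
  `R, ε > 0`, there is a linear isometry `B` with `Q₁ ∩ B_R(s₁)` two-way `ε`-matched to
  `s₁ + B(Q₂.points − s₂)` (compose the two matchings to the common template through `A₁ ∘ A₂⁻¹`,
  as in `SlackRigidityNegative.rigidFor_unique_up_to_isometry`).  With `Q₁ = Q₂` this says every
  periodic minimiser is vertex-transitive up to every tolerance.
* `not_slackRigidity_of_incongruent_minimisers` — the REFUTATION INTERFACE: two periodic minimisers
  with a pair of sites whose `R`-environments are not `ε`-congruent for some `(R, ε)` (an exact
  fcc/hcp-type tie, or one non-vertex-transitive optimal polytype taken twice with an h-site and a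
  c-site) give `¬ SlackRigidity`.

All `[folklore]`.
-/

noncomputable section

open scoped BigOperators Topology
open Filter Set Metric

namespace Summit.AtomisticToContinuum.Crystallization.Theorems.SlackRigidityPinsMinimisers

open Literature.MathematicalPhysics.StatisticalMechanics
open Summit.AtomisticToContinuum.Crystallization.Theses.ThreeConeCertificate (SlackRigidity)
open Summit.AtomisticToContinuum.Crystallization.Theorems.SlackRigidityNegative

/-- **Any two periodic minimisers are locally congruent at all sites and scales**, given a witness
`P₀` of the crux: match both to `P₀` at `(R + 1, ε/2)` and compose through `A₁ ∘ A₂⁻¹`.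
[folklore] -/
theorem minimisers_locally_congruent {P₀ : PeriodicConfiguration 3} (hP₀ : RigidFor P₀)
    {Q₁ Q₂ : PeriodicConfiguration 3}
    (hQ₁ : ∀ Q' : PeriodicConfiguration 3,
      Q₁.energyPerParticle lennardJones ≤ Q'.energyPerParticle lennardJones)
    (hQ₂ : ∀ Q' : PeriodicConfiguration 3,
      Q₂.energyPerParticle lennardJones ≤ Q'.energyPerParticle lennardJones)
    {s₁ s₂ : E3} (hs₁ : s₁ ∈ Q₁.points) (hs₂ : s₂ ∈ Q₂.points) {R ε : ℝ} (hR : 0 < R)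
    (hε : 0 < ε) :
    ∃ B : E3 →ₗᵢ[ℝ] E3,
      (∀ q₂ ∈ Q₂.points, dist q₂ s₂ ≤ R → ∃ q₁ ∈ Q₁.points, dist q₁ (s₁ + B (q₂ - s₂)) ≤ ε) ∧
      (∀ q₁ ∈ Q₁.points, dist q₁ s₁ ≤ R → ∃ q₂ ∈ Q₂.points, dist q₁ (s₁ + B (q₂ - s₂)) ≤ ε) := by
  obtain ⟨ε₁, hε₁, hε₁ε, hε₁1⟩ : ∃ ε₁ : ℝ, 0 < ε₁ ∧ 2 * ε₁ ≤ ε ∧ ε₁ ≤ 1 :=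
    ⟨min (ε / 2) 1, lt_min (by linarith) one_pos, by linarith [min_le_left (ε / 2) (1 : ℝ)],
      min_le_right _ _⟩
  have hR1 : 0 < R + 1 := by linarith
  obtain ⟨A₁, ha1, hb1⟩ := siteMatched_of_rigidFor hP₀ hQ₁ hs₁ hR1 hε₁
  obtain ⟨A₂, ha2, hb2⟩ := siteMatched_of_rigidFor hP₀ hQ₂ hs₂ hR1 hε₁
  -- `B = A₁ ∘ A₂⁻¹` (finite dimension upgrades `A₂` to an equivalence)
  set B : E3 →ₗᵢ[ℝ] E3 :=
    ((A₂.toLinearIsometryEquiv rfl).symm.trans (A₁.toLinearIsometryEquiv rfl)).toLinearIsometry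
    with hB
  have hBA : ∀ p : E3, B (A₂ p) = A₁ p := fun p => by
    have h2 : A₂ p = (A₂.toLinearIsometryEquiv rfl) p := by simp
    rw [hB, LinearIsometryEquiv.coe_toLinearIsometry, LinearIsometryEquiv.coe_trans,
      Function.comp_apply, h2, LinearIsometryEquiv.symm_apply_apply]
    simp
  -- the composed chart moves image points by at most the second matching error
  have hkey : ∀ p q₂ : E3, dist (s₁ + A₁ p) (s₁ + B (q₂ - s₂)) = dist q₂ (s₂ + A₂ p) :=
    fun p q₂ =>
    calc dist (s₁ + A₁ p) (s₁ + B (q₂ - s₂)) = dist (A₁ p) (B (q₂ - s₂)) := dist_add_left _ _ _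
      _ = dist (B (A₂ p)) (B (q₂ - s₂)) := by rw [hBA]
      _ = dist (A₂ p) (q₂ - s₂) := B.dist_map _ _
      _ = dist (s₂ + A₂ p) (s₂ + (q₂ - s₂)) := (dist_add_left _ _ _).symm
      _ = dist q₂ (s₂ + A₂ p) := by rw [add_sub_cancel, dist_comm]
  -- a template point matched to a particle of the `R`-ball (plus `ε₁`) has norm `≤ R + 1`
  have hnorm : ∀ (A : E3 →ₗᵢ[ℝ] E3) (s q p : E3), dist q s ≤ R → dist q (s + A p) ≤ ε₁ →
      ‖p‖ ≤ R + 1 := fun A s q p hqs hqp => by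
    rw [← dist_add_linearIsometry A s p]
    calc dist (s + A p) s ≤ dist (s + A p) q + dist q s := dist_triangle _ _ _
      _ ≤ ε₁ + R := by rw [dist_comm] at hqp; linarith
      _ ≤ R + 1 := by linarith
  refine ⟨B, fun q₂ hq₂ hq₂R => ?_, fun q₁ hq₁ hq₁R => ?_⟩
  · obtain ⟨p, hp, hq₂p⟩ := hb2 q₂ hq₂ (by linarith)
    obtain ⟨q₁, hq₁, hq₁p⟩ := ha1 p hp (hnorm A₂ s₂ q₂ p hq₂R hq₂p)
    refine ⟨q₁, hq₁, ?_⟩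
    calc dist q₁ (s₁ + B (q₂ - s₂))
        ≤ dist q₁ (s₁ + A₁ p) + dist (s₁ + A₁ p) (s₁ + B (q₂ - s₂)) := dist_triangle _ _ _
      _ = dist q₁ (s₁ + A₁ p) + dist q₂ (s₂ + A₂ p) := by rw [hkey]
      _ ≤ ε₁ + ε₁ := add_le_add hq₁p hq₂p
      _ ≤ ε := by linarith
  · obtain ⟨p, hp, hq₁p⟩ := hb1 q₁ hq₁ (by linarith)
    obtain ⟨q₂, hq₂, hq₂p⟩ := ha2 p hp (hnorm A₁ s₁ q₁ p hq₁R hq₁p)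
    refine ⟨q₂, hq₂, ?_⟩
    calc dist q₁ (s₁ + B (q₂ - s₂))
        ≤ dist q₁ (s₁ + A₁ p) + dist (s₁ + A₁ p) (s₁ + B (q₂ - s₂)) := dist_triangle _ _ _
      _ = dist q₁ (s₁ + A₁ p) + dist q₂ (s₂ + A₂ p) := by rw [hkey]
      _ ≤ ε₁ + ε₁ := add_le_add hq₁p hq₂p
      _ ≤ ε := by linarith

/-- **`SlackRigidity` ⇒ all periodic Lennard-Jones minimisers are mutually locally congruent**, at
every pair of sites and every `(R, ε)` (registered sub-goal of crux stmt-AtomisticToContinuum-11960,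
binder-free form). [folklore] -/
theorem slackRigidity_minimisers_congruent :
    Summit.AtomisticToContinuum.Crystallization.Theses.ThreeConeCertificate.SlackRigidity →
      ∀ Q₁ Q₂ : PeriodicConfiguration 3,
        (∀ Q' : PeriodicConfiguration 3,
          Q₁.energyPerParticle lennardJones ≤ Q'.energyPerParticle lennardJones) →
        (∀ Q' : PeriodicConfiguration 3,
          Q₂.energyPerParticle lennardJones ≤ Q'.energyPerParticle lennardJones) →
        ∀ s₁ ∈ Q₁.points, ∀ s₂ ∈ Q₂.points, ∀ R ε : ℝ, 0 < R → 0 < ε →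
          ∃ B : EuclideanSpace ℝ (Fin 3) →ₗᵢ[ℝ] EuclideanSpace ℝ (Fin 3),
            (∀ q₂ ∈ Q₂.points, dist q₂ s₂ ≤ R →
              ∃ q₁ ∈ Q₁.points, dist q₁ (s₁ + B (q₂ - s₂)) ≤ ε) ∧
            (∀ q₁ ∈ Q₁.points, dist q₁ s₁ ≤ R →
              ∃ q₂ ∈ Q₂.points, dist q₁ (s₁ + B (q₂ - s₂)) ≤ ε) := by
  intro h Q₁ Q₂ hQ₁ hQ₂ s₁ hs₁ s₂ hs₂ R ε hR hε
  obtain ⟨P₀, hP₀⟩ := slackRigidity_iff.1 h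
  exact minimisers_locally_congruent hP₀ hQ₁ hQ₂ hs₁ hs₂ hR hε

/-- **Every periodic minimiser is vertex-transitive up to every tolerance** under the crux (the
case `Q₁ = Q₂`). [folklore] -/
theorem slackRigidity_minimiser_vertexTransitive (h : SlackRigidity) {Q : PeriodicConfiguration 3}
    (hQ : ∀ Q' : PeriodicConfiguration 3,
      Q.energyPerParticle lennardJones ≤ Q'.energyPerParticle lennardJones)
    {s₁ s₂ : E3} (hs₁ : s₁ ∈ Q.points) (hs₂ : s₂ ∈ Q.points) {R ε : ℝ} (hR : 0 < R) (hε : 0 < ε) :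
    ∃ B : E3 →ₗᵢ[ℝ] E3,
      (∀ q₂ ∈ Q.points, dist q₂ s₂ ≤ R → ∃ q₁ ∈ Q.points, dist q₁ (s₁ + B (q₂ - s₂)) ≤ ε) ∧
      (∀ q₁ ∈ Q.points, dist q₁ s₁ ≤ R → ∃ q₂ ∈ Q.points, dist q₁ (s₁ + B (q₂ - s₂)) ≤ ε) :=
  slackRigidity_minimisers_congruent h Q Q hQ hQ s₁ hs₁ s₂ hs₂ R ε hR hε

/-- **Refutation interface.** Two periodic Lennard-Jones minimisers `Q₁, Q₂` with sites `s₁, s₂`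
whose `R`-environments are NOT `ε`-congruent under any linear isometry (for one `R, ε > 0`) refute
the crux: `¬ SlackRigidity`.  (An exact fcc/hcp-type tie, or a non-vertex-transitive optimal
polytype used as both `Q₁` and `Q₂` with an h-site and a c-site, would be such data.) [folklore] -/
theorem not_slackRigidity_of_incongruent_minimisers {Q₁ Q₂ : PeriodicConfiguration 3}
    (hQ₁ : ∀ Q' : PeriodicConfiguration 3,
      Q₁.energyPerParticle lennardJones ≤ Q'.energyPerParticle lennardJones)
    (hQ₂ : ∀ Q' : PeriodicConfiguration 3,
      Q₂.energyPerParticle lennardJones ≤ Q'.energyPerParticle lennardJones)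
    {s₁ s₂ : E3} (hs₁ : s₁ ∈ Q₁.points) (hs₂ : s₂ ∈ Q₂.points) {R ε : ℝ} (hR : 0 < R) (hε : 0 < ε)
    (hne : ∀ B : E3 →ₗᵢ[ℝ] E3,
      (∀ q₂ ∈ Q₂.points, dist q₂ s₂ ≤ R → ∃ q₁ ∈ Q₁.points, dist q₁ (s₁ + B (q₂ - s₂)) ≤ ε) →
      ¬ (∀ q₁ ∈ Q₁.points, dist q₁ s₁ ≤ R → ∃ q₂ ∈ Q₂.points, dist q₁ (s₁ + B (q₂ - s₂)) ≤ ε)) :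
    ¬ SlackRigidity := fun h => by
  obtain ⟨B, h1, h2⟩ := slackRigidity_minimisers_congruent h Q₁ Q₂ hQ₁ hQ₂ s₁ hs₁ s₂ hs₂ R ε hR hε
  exact hne B h1 h2

end Summit.AtomisticToContinuum.Crystallization.Theorems.SlackRigidityPinsMinimisers

end
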